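import Literature.RepresentationTheory.IsotypicEvaluation
import Literature.NumberTheory.Automorphic.SmoothRepresentation
import Mathlib.RepresentationTheory.Subrepresentation
import Mathlib.LinearAlgebra.Dimension.Constructions
import Mathlib.LinearAlgebra.Dimension.Finrank
import Mathlib.RingTheory.Flat.Basic
import HarnessLib

/-!
# Rank of joint fixed spaces in an isotypic representation: `dim V^{K, 𝒪} = dim τ^K · dim ({f t₀} ∩ V^{𝒪})`

Topic `RepresentationTheory`; companion of ★ `IsotypicEvaluation` (the isotypic calculus `V ≅ τ ⊗ Hom_G(τ, π)` and «fixed tensors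
come from fixed vectors»).  THEOREMS ONLY (no definition, no instance): the evaluation map at a vector `t₀` and the joint fixed spaces
are not introduced as constants — every statement is about arbitrary objects with their characterising property (`hev`, `hP`, `hQ`, `hR`).

Setting: `k` a field, `G` a group, `τ : G → GL(T)` IRREDUCIBLE with scalar commutant (`hτ`, as in ★ `IsotypicEvaluation`),
`π : G → GL(V)` `τ`-ISOTYPIC (`isotypicComponent k[G] π.asModule τ.asModule = ⊤`), `K ≤ G`, and a set `𝒪 ⊆ End_k V` of operators
COMMUTING with `π(G)` (in the application: the other coordinates of a restricted product and a box subgroup away from the place).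
* §1 `isSemisimpleModule_of_isotypicComponent_eq_top`, `isotypicComponent_subrep_eq_top` — a `τ`-isotypic module is semisimple, and every
  `π(G)`-stable `k`-submodule is again `τ`-isotypic (as the restricted representation `Subrepresentation.toRepresentation`).
* §2 **`finrank_fixed_eq_mul`** — `dim V^{K,𝒪} = dim τ^K · dim Hom_G(τ, π)^{𝒪}` where `V^{K,𝒪}` is the joint fixed space of `π(K)` and `𝒪`
  and `Hom_G(τ,π)^{𝒪}` the intertwiners fixed by post-composition with `𝒪` (transport along `e : τ ⊗ Hom_G(τ,π) ≃ V`, `e(t ⊗ f) = f t`,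
  which intertwines `τ(g) ⊗ 1` with `π(g)` and `1 ⊗ (u ∘ ·)` with `u`; ★ `mem_range_mapIncl_of_forall_eq`; `Module.finrank_tensorProduct`).
* §3 evaluation at `t₀ ∈ τ^K ∖ 0`: injective on `Hom_G(τ, π)` (`eval_injective`), its image `{f t₀}` is stable under every operator commuting
  with `π(G)` (`map_range_eval_le`), and it carries `Hom_G(τ,π)^{𝒪}` onto `{f t₀} ∩ V^{𝒪}` (`map_eval_eq_range_inf`); whence
  **`finrank_fixed_eq_mul_finrank_range_inf`**: `dim V^{K,𝒪} = dim τ^K · dim ({f t₀} ∩ V^{𝒪})`, and `exists_fixedPoints_ne_zero`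
  (`dim V^{K,𝒪} ≥ 1 ⇒ τ^K ≠ 0`).
This is the one-place step of the DIMENSION COUNT behind «the local types of an admissible representation are spherical at almost every
place» (Flath 1979, §2 Example 2: `(⊗' V_v)^{∏ K_v} = ⊗ V_v^{K_v}`, read backwards without a tensor-product structure): iterating it over a
finite set of places inside the `K_∞ K^S`-fixed vectors of an admissible representation bounds `∏_v dim τ_v^{K_v}` by `dim V^U`
(`Automorphic/LocalTypeSphericalAlmostAll`).  Cell hodgecm-mathlib, floor 0, (C)-line `F0_P2CohFinComponentIsThetaC`, CF road file (4).

## References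
* D. Flath, *Decomposition of representations into tensor products*, PSPM 33.1 (1979), §2 Example 2, Thm. 1–3.
* D. Bump, *Automorphic Forms and Representations* (1997), §3.4, Prop. 3.4.1–3.4.2 (PDF p. 302).
* N. Bourbaki, *Algèbre* VIII, §4 n°4.
-/

set_option autoImplicit false

noncomputable section

open TensorProduct Module

namespace Literature.RepresentationTheory

universe u

open scoped MonoidAlgebra

variable {k : Type*} [Field k] {G : Type*} [Group G]
variable {T W : Type*} [AddCommGroup T] [Module k T] [AddCommGroup W] [Module k W]
variable (τ : Representation k G T) (σ : Representation k G W)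

/-! ## §1 Stable submodules of an isotypic representation are isotypic -/

/-- A `τ`-isotypic module (`isotypicComponent = ⊤`, `τ` irreducible) is semisimple. [cite: Bump1997, Prop. 3.4.1] -/
theorem isSemisimpleModule_of_isotypicComponent_eq_top [τ.IsIrreducible]
    (hσ : isotypicComponent k[G] σ.asModule τ.asModule = ⊤) : IsSemisimpleModule k[G] σ.asModule := by
  refine IsSemisimpleModule.of_sSup_simples_eq_top (top_le_iff.mp ?_)
  rw [← hσ]
  exact sSup_le_sSup fun m ⟨e⟩ => (IsSimpleModule.congr e : IsSimpleModule k[G] m)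

/-- The restriction of `σ` to a `σ(G)`-stable `k`-submodule `Y`. (Mathlib `Subrepresentation.toRepresentation`.) [cite: Bump1997, Prop. 3.4.1] -/
theorem subrep_apply {Y : Submodule k W} (hY : ∀ g : G, ∀ y ∈ Y, σ g y ∈ Y) (g : G) (y : Y) :
    (((⟨Y, fun g _ hv => hY g _ hv⟩ : Subrepresentation σ).toRepresentation g y : Y) : W) = σ g y := rfl

/-- **A `σ(G)`-stable submodule of a `τ`-isotypic representation is `τ`-isotypic** (as the restricted representation):
the inclusion is an injective `k[G]`-linear map into a semisimple isotypic module. [cite: Bump1997, Prop. 3.4.1] -/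
theorem isotypicComponent_subrep_eq_top [τ.IsIrreducible]
    (hσ : isotypicComponent k[G] σ.asModule τ.asModule = ⊤) {Y : Submodule k W} (hY : ∀ g : G, ∀ y ∈ Y, σ g y ∈ Y) :
    isotypicComponent k[G] ((⟨Y, fun g _ hv => hY g _ hv⟩ : Subrepresentation σ).toRepresentation).asModule τ.asModule = ⊤ := by
  set σY := ((⟨Y, fun g _ hv => hY g _ hv⟩ : Subrepresentation σ).toRepresentation) with hσY
  haveI : IsSemisimpleModule k[G] σ.asModule := isSemisimpleModule_of_isotypicComponent_eq_top τ σ hσ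
  -- the inclusion as a `k[G]`-linear map
  let incl : σY.IntertwiningMap σ := ⟨Y.subtype, fun g => by ext y; rfl⟩
  let f : σY.asModule →ₗ[k[G]] σ.asModule := Representation.IntertwiningMap.equivLinearMapAsModule σY σ incl
  have hf : Function.Injective f := fun a b h => by
    have h' : ((σY.asModuleEquiv a : Y) : W) = ((σY.asModuleEquiv b : Y) : W) := h
    exact σY.asModuleEquiv.injective (Subtype.ext h')
  haveI : IsSemisimpleModule k[G] σY.asModule :=
    (LinearEquiv.ofInjective f hf).isSemisimpleModule_iff.mpr inferInstance
  rw [isotypicComponent_eq_top_iff]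
  exact (IsIsotypicOfType.of_isotypicComponent_eq_top hσ).of_injective f hf


/-! ## §2 Post-composition by an operator commuting with `π(G)`, and the rank of a joint fixed space -/

section Rank

variable {V : Type*} [AddCommGroup V] [Module k V] (π : Representation k G V)

/-- Post-composition of an intertwiner `τ → π` with an operator commuting with `π(G)` is an intertwiner (pointwise form).
[cite: Bump1997, Prop. 3.4.2] -/
theorem comp_isIntertwining (u : V →ₗ[k] V) (hu : ∀ g : G, u ∘ₗ π g = π g ∘ₗ u) (f : τ.IntertwiningMap π) (g : G) (t : T) :
    (u ∘ₗ f.toLinearMap) (τ g t) = π g ((u ∘ₗ f.toLinearMap) t) := by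
  show u (f (τ g t)) = π g (u (f t))
  rw [f.isIntertwining]
  exact LinearMap.congr_fun (hu g) (f t)

/-- **Rank of the joint fixed space of `K ≤ G` and a commuting operator set `𝒪` on a `τ`-isotypic representation**:
`dim V^{K, 𝒪} = dim τ^K · dim Hom_G(τ, π)^{𝒪}` — transport of `V ≅ τ ⊗ Hom_G(τ, π)` (★ `intertwiningMap_exists_linearEquiv_apply_tmul`)
and «fixed tensors come from fixed vectors» (★ `mem_range_mapIncl_of_forall_eq`); `finrank` of infinite-dimensional spaces is `0`
on both sides consistently (`Module.finrank_tensorProduct`).  (Flath 1979, §2 Example 2: `(⊗ V_v)^{∏ K_v} = ⊗ V_v^{K_v}`.)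
[cite: FlathCorvallis1979, §2 Example 2] [cite: Bump1997, Prop. 3.4.2] -/
theorem finrank_fixed_eq_mul [τ.IsIrreducible] (hτ : ∀ φ : τ.IntertwiningMap τ, ∃ c : k, ∀ x, φ x = c • x)
    (hπ : isotypicComponent k[G] π.asModule τ.asModule = ⊤) (K : Subgroup G)
    (𝒪 : Set (V →ₗ[k] V)) (h𝒪 : ∀ u ∈ 𝒪, ∀ g : G, u ∘ₗ π g = π g ∘ₗ u)
    (P : Submodule k V) (hP : ∀ v, v ∈ P ↔ (∀ g ∈ K, π g v = v) ∧ ∀ u ∈ 𝒪, u v = v)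
    (Q : Submodule k (τ.IntertwiningMap π)) (hQ : ∀ f, f ∈ Q ↔ ∀ u ∈ 𝒪, ∀ t, u (f t) = f t) :
    Module.finrank k P = Module.finrank k (τ.fixedPoints K) * Module.finrank k Q := by
  classical
  obtain ⟨e, he⟩ := intertwiningMap_exists_linearEquiv_apply_tmul τ π hτ hπ
  -- post-composition operators on `Hom_G(τ, π)`
  let pc : ∀ u ∈ 𝒪, τ.IntertwiningMap π →ₗ[k] τ.IntertwiningMap π := fun u hu =>
    { toFun := fun f => ⟨u ∘ₗ f.toLinearMap, fun g => by ext t; exact comp_isIntertwining τ π u (h𝒪 u hu) f g t⟩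
      map_add' := fun f f' => by ext t; simp
      map_smul' := fun c f => by ext t; simp }
  have hpc : ∀ u (hu : u ∈ 𝒪) (f : τ.IntertwiningMap π) (t : T), pc u hu f t = u (f t) := fun u hu f t => rfl
  -- equivariance of `e`
  have hEg : ∀ (g : G) (x : T ⊗[k] τ.IntertwiningMap π), e ((τ g).rTensor _ x) = π g (e x) := by
    intro g x
    induction x using TensorProduct.induction_on with
    | zero => simp
    | tmul t f => rw [LinearMap.rTensor_tmul, he, he, f.isIntertwining]
    | add x y hx hy => simp only [map_add, hx, hy]
  have hEu : ∀ u (hu : u ∈ 𝒪) (x : T ⊗[k] τ.IntertwiningMap π), e ((pc u hu).lTensor T x) = u (e x) := by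
    intro u hu x
    induction x using TensorProduct.induction_on with
    | zero => simp
    | tmul t f => rw [LinearMap.lTensor_tmul, he, he, hpc u hu]
    | add x y hx hy => simp only [map_add, hx, hy]
  -- the image of `τ^K ⊗ Q` under `e` is `P`
  set P₀ : Submodule k T := τ.fixedPoints K with hP₀
  have himage : Submodule.map (e : T ⊗[k] τ.IntertwiningMap π →ₗ[k] V) (LinearMap.range (TensorProduct.mapIncl P₀ Q)) = P := by
    apply le_antisymm
    · rintro v ⟨x, ⟨y, rfl⟩, rfl⟩
      induction y using TensorProduct.induction_on with
      | zero => simp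
      | tmul t f =>
        rw [TensorProduct.mapIncl, TensorProduct.map_tmul, Submodule.coe_subtype, Submodule.coe_subtype,
          LinearEquiv.coe_coe, he, hP]
        refine ⟨fun g hg => ?_, fun u hu => ((hQ f.1).1 f.2) u hu t⟩
        rw [← f.1.isIntertwining, (τ.mem_fixedPoints K _).1 t.2 g hg]
      | add y z hy hz => rw [map_add, map_add]; exact P.add_mem hy hz
    · intro v hv
      obtain ⟨hvK, hv𝒪⟩ := (hP v).1 hv
      set x := e.symm v with hx
      have hxK : ∀ g ∈ K, (τ g).rTensor _ x = x := fun g hg =>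
        e.injective (by rw [hEg, hx, LinearEquiv.apply_symm_apply, hvK g hg])
      have hx𝒪 : ∀ u (hu : u ∈ 𝒪), (pc u hu).lTensor T x = x := fun u hu =>
        e.injective (by rw [hEu u hu, hx, LinearEquiv.apply_symm_apply, hv𝒪 u hu])
      have hmem := mem_range_mapIncl_of_forall_eq P₀ Q ((fun g : K => τ (g : G)) '' Set.univ)
        (Set.range fun u : 𝒪 => pc u.1 u.2)
        (fun t ht => (τ.mem_fixedPoints K t).2 fun g hg => ht _ ⟨⟨g, hg⟩, trivial, rfl⟩)
        (fun f hf => (hQ f).2 fun u hu t => by rw [← hpc u hu]; exact congrArg (fun m : τ.IntertwiningMap π => m t) (hf _ ⟨⟨u, hu⟩, rfl⟩))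
        x (by rintro _ ⟨⟨g, hg⟩, -, rfl⟩; exact hxK g hg) (by rintro _ ⟨⟨u, hu⟩, rfl⟩; exact hx𝒪 u hu)
      exact ⟨x, hmem, by rw [hx, LinearEquiv.coe_coe, LinearEquiv.apply_symm_apply]⟩
  -- `mapIncl` is injective over a field, and `e` preserves the rank
  have hinj : Function.Injective (TensorProduct.mapIncl P₀ Q) := by
    rw [TensorProduct.mapIncl, ← LinearMap.rTensor_comp_lTensor]
    exact (Module.Flat.rTensor_preserves_injective_linearMap _ P₀.subtype_injective).comp
      (Module.Flat.lTensor_preserves_injective_linearMap _ Q.subtype_injective)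
  rw [← himage, LinearEquiv.finrank_map_eq, LinearMap.finrank_range_of_inj hinj, Module.finrank_tensorProduct]


/-! ## §3 Evaluation at a fixed vector: `Hom_G(τ, π)^{𝒪} ≅ {f t₀} ∩ V^{𝒪}` -/

/-- Evaluation of intertwiners at a vector `t₀` is a `k`-linear map (existence form; no definition is introduced).
[cite: Bump1997, Prop. 3.4.2] -/
theorem exists_eval (t₀ : T) : ∃ ev : τ.IntertwiningMap π →ₗ[k] V, ∀ f, ev f = f t₀ :=
  ⟨{ toFun := fun f => f t₀, map_add' := fun _ _ => rfl, map_smul' := fun _ _ => rfl }, fun _ => rfl⟩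

/-- **Evaluation at a non-zero vector of an irreducible `τ` is injective on `Hom_G(τ, π)`** (an intertwiner vanishing at
`t₀ ≠ 0` has a non-zero kernel, hence is `0`). [cite: Bump1997, Prop. 3.4.2] -/
theorem eval_injective [τ.IsIrreducible] {t₀ : T} (ht₀ : t₀ ≠ 0) (ev : τ.IntertwiningMap π →ₗ[k] V)
    (hev : ∀ f, ev f = f t₀) : Function.Injective ev := by
  intro f f' h
  rw [hev, hev] at h
  have h0 : (f - f') t₀ = 0 := by rw [Representation.IntertwiningMap.coe_sub, Pi.sub_apply, h, sub_self]
  rcases Representation.IsIrreducible.injective_or_eq_zero (f - f') with hinj | hzero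
  · exact absurd (hinj (by rw [h0, map_zero])) ht₀
  · exact sub_eq_zero.1 hzero

/-- The image `{f t₀}` of the evaluation map is stable under every operator commuting with `π(G)`. [cite: Bump1997, Prop. 3.4.2] -/
theorem map_range_eval_le (t₀ : T) (ev : τ.IntertwiningMap π →ₗ[k] V) (hev : ∀ f, ev f = f t₀)
    (c : V →ₗ[k] V) (hc : ∀ g : G, c ∘ₗ π g = π g ∘ₗ c) :
    ∀ v ∈ LinearMap.range ev, c v ∈ LinearMap.range ev := by
  rintro v ⟨f, rfl⟩
  refine ⟨⟨c ∘ₗ f.toLinearMap, fun g => by ext t; exact comp_isIntertwining τ π c hc f g t⟩, ?_⟩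
  rw [hev, hev]
  rfl

/-- **`Hom_G(τ, π)^{𝒪}` is carried by evaluation onto `{f t₀} ∩ V^{𝒪}`**: an intertwiner `f` is fixed by post-composition with
`u ∈ 𝒪` iff `u (f t₀) = f t₀` (both sides are intertwiners agreeing at `t₀ ≠ 0`). [cite: Bump1997, Prop. 3.4.2] -/
theorem map_eval_eq_range_inf [τ.IsIrreducible] {t₀ : T} (ht₀ : t₀ ≠ 0) (ev : τ.IntertwiningMap π →ₗ[k] V)
    (hev : ∀ f, ev f = f t₀) (𝒪 : Set (V →ₗ[k] V)) (h𝒪 : ∀ u ∈ 𝒪, ∀ g : G, u ∘ₗ π g = π g ∘ₗ u)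
    (Q : Submodule k (τ.IntertwiningMap π)) (hQ : ∀ f, f ∈ Q ↔ ∀ u ∈ 𝒪, ∀ t, u (f t) = f t)
    (R : Submodule k V) (hR : ∀ v, v ∈ R ↔ ∀ u ∈ 𝒪, u v = v) :
    Q.map ev = LinearMap.range ev ⊓ R := by
  apply le_antisymm
  · rintro v ⟨f, hf, rfl⟩
    refine ⟨⟨f, rfl⟩, (hR _).2 fun u hu => ?_⟩
    rw [hev]
    exact (hQ f).1 hf u hu t₀
  · rintro v ⟨⟨f, rfl⟩, hvR⟩
    refine ⟨f, (hQ f).2 fun u hu t => ?_, rfl⟩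
    -- `u ∘ f` and `f` are intertwiners agreeing at `t₀`
    let uf : τ.IntertwiningMap π := ⟨u ∘ₗ f.toLinearMap, fun g => by ext t'; exact comp_isIntertwining τ π u (h𝒪 u hu) f g t'⟩
    have h1 : ev uf = ev f := by
      rw [hev, hev]
      have := (hR _).1 hvR u hu
      rw [hev] at this
      exact this
    have h2 : uf = f := eval_injective τ π ht₀ ev hev h1
    exact congrArg (fun m : τ.IntertwiningMap π => m t) h2

/-- Consequently `dim Hom_G(τ, π)^{𝒪} = dim ({f t₀} ∩ V^{𝒪})`. [cite: Bump1997, Prop. 3.4.2] -/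
theorem finrank_eq_finrank_range_inf [τ.IsIrreducible] {t₀ : T} (ht₀ : t₀ ≠ 0) (ev : τ.IntertwiningMap π →ₗ[k] V)
    (hev : ∀ f, ev f = f t₀) (𝒪 : Set (V →ₗ[k] V)) (h𝒪 : ∀ u ∈ 𝒪, ∀ g : G, u ∘ₗ π g = π g ∘ₗ u)
    (Q : Submodule k (τ.IntertwiningMap π)) (hQ : ∀ f, f ∈ Q ↔ ∀ u ∈ 𝒪, ∀ t, u (f t) = f t)
    (R : Submodule k V) (hR : ∀ v, v ∈ R ↔ ∀ u ∈ 𝒪, u v = v) :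
    Module.finrank k Q = Module.finrank k ↥(LinearMap.range ev ⊓ R) := by
  rw [← map_eval_eq_range_inf τ π ht₀ ev hev 𝒪 h𝒪 Q hQ R hR]
  exact LinearEquiv.finrank_eq (Submodule.equivMapOfInjective ev (eval_injective τ π ht₀ ev hev) Q)

/-- **The one-place rank identity used in the dimension count**: `dim V^{K, 𝒪} = dim τ^K · dim ({f t₀} ∩ V^{𝒪})` for a
`τ`-isotypic `π`, `t₀ ∈ τ^K` non-zero. [cite: FlathCorvallis1979, §2 Example 2] [cite: Bump1997, Prop. 3.4.2] -/
theorem finrank_fixed_eq_mul_finrank_range_inf [τ.IsIrreducible]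
    (hτ : ∀ φ : τ.IntertwiningMap τ, ∃ c : k, ∀ x, φ x = c • x)
    (hπ : isotypicComponent k[G] π.asModule τ.asModule = ⊤) (K : Subgroup G)
    (𝒪 : Set (V →ₗ[k] V)) (h𝒪 : ∀ u ∈ 𝒪, ∀ g : G, u ∘ₗ π g = π g ∘ₗ u)
    (P : Submodule k V) (hP : ∀ v, v ∈ P ↔ (∀ g ∈ K, π g v = v) ∧ ∀ u ∈ 𝒪, u v = v)
    (R : Submodule k V) (hR : ∀ v, v ∈ R ↔ ∀ u ∈ 𝒪, u v = v)
    {t₀ : T} (ht₀K : t₀ ∈ τ.fixedPoints K) (ht₀ : t₀ ≠ 0)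
    (ev : τ.IntertwiningMap π →ₗ[k] V) (hev : ∀ f, ev f = f t₀) :
    Module.finrank k P = Module.finrank k (τ.fixedPoints K) * Module.finrank k ↥(LinearMap.range ev ⊓ R) := by
  classical
  let Q : Submodule k (τ.IntertwiningMap π) :=
    { carrier := {f | ∀ u ∈ 𝒪, ∀ t, u (f t) = f t}
      add_mem' := fun {f f'} hf hf' u hu t => by
        rw [Representation.IntertwiningMap.coe_add, Pi.add_apply, map_add, hf u hu, hf' u hu]
      zero_mem' := fun u hu t => by simp
      smul_mem' := fun c f hf u hu t => by
        rw [Representation.IntertwiningMap.coe_smul, Pi.smul_apply, map_smul, hf u hu] }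
  have hQ : ∀ f, f ∈ Q ↔ ∀ u ∈ 𝒪, ∀ t, u (f t) = f t := fun f => Iff.rfl
  have _ := ht₀K
  rw [finrank_fixed_eq_mul τ π hτ hπ K 𝒪 h𝒪 P hP Q hQ, finrank_eq_finrank_range_inf τ π ht₀ ev hev 𝒪 h𝒪 Q hQ R hR]

/-- From `dim V^{K,𝒪} ≥ 1` the factor `τ^K` is non-zero: a non-zero `K`-fixed vector `t₀` exists. [cite: FlathCorvallis1979, §2 Example 2] -/
theorem exists_fixedPoints_ne_zero [τ.IsIrreducible]
    (hτ : ∀ φ : τ.IntertwiningMap τ, ∃ c : k, ∀ x, φ x = c • x)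
    (hπ : isotypicComponent k[G] π.asModule τ.asModule = ⊤) (K : Subgroup G)
    (𝒪 : Set (V →ₗ[k] V)) (h𝒪 : ∀ u ∈ 𝒪, ∀ g : G, u ∘ₗ π g = π g ∘ₗ u)
    (P : Submodule k V) (hP : ∀ v, v ∈ P ↔ (∀ g ∈ K, π g v = v) ∧ ∀ u ∈ 𝒪, u v = v)
    (hP1 : 1 ≤ Module.finrank k P) : ∃ t₀ ∈ τ.fixedPoints K, t₀ ≠ 0 := by
  classical
  let Q : Submodule k (τ.IntertwiningMap π) :=
    { carrier := {f | ∀ u ∈ 𝒪, ∀ t, u (f t) = f t}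
      add_mem' := fun {f f'} hf hf' u hu t => by
        rw [Representation.IntertwiningMap.coe_add, Pi.add_apply, map_add, hf u hu, hf' u hu]
      zero_mem' := fun u hu t => by simp
      smul_mem' := fun c f hf u hu t => by
        rw [Representation.IntertwiningMap.coe_smul, Pi.smul_apply, map_smul, hf u hu] }
  have h := finrank_fixed_eq_mul τ π hτ hπ K 𝒪 h𝒪 P hP Q (fun f => Iff.rfl)
  rcases Nat.eq_zero_or_pos (Module.finrank k (τ.fixedPoints K)) with h0 | hpos
  · rw [h0, zero_mul] at h
    omega
  haveI : Nontrivial (τ.fixedPoints K) := Module.nontrivial_of_finrank_pos hpos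
  obtain ⟨t, ht⟩ := exists_ne (0 : τ.fixedPoints K)
  exact ⟨t.1, t.2, fun h0 => ht (Subtype.ext h0)⟩

end Rank

end Literature.RepresentationTheory

end
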